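import Summits.BirchSwinnertonDyer.BirchSwinnertonDyer.Theorems.AdditiveBranchIMCGordTwoRankZeroOffCaseOneTamagawaParityR0Twist
import Summits.BirchSwinnertonDyer.BirchSwinnertonDyer.Theorems.AdditiveBranchIMCGordTwoRankZeroOffCaseOneFieldSupplyR0
import Summits.BirchSwinnertonDyer.Rank1Residual.X11b.TwistTransportTam
import Summits.BirchSwinnertonDyer.Rank1Residual.Additive.N10LowerHalfStatements
import HarnessLib

/-!
# Registered stub `stub_tamagawaParityR0` (S6, G1) of line `genus-stringent-road-k` — its statement PROVED
# VERBATIM as `GenusStringentRoadK.tamagawaParityR0` (crux `AdditiveBranchIMC.GordTwoRankZeroOffCaseOne`, item stmt-BirchSwinnertonDyer-19357;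
# helper file, stub-worker S6 under the LEAD prover g22, wave 1)

HONEST FRAMING. Nothing about the Birch–Swinnerton-Dyer conjecture is proved here and the crux item
stays OPEN: this file is a HELPER for crux 19357. It proves, sorry-free and from tree theorems only,
the LOCAL TAMAGAWA PARITY statement `TamagawaParityR0` of the skeleton
`Cruxes/GordTwoRankZeroOffCaseOne/Lines/genus_stringent_road_k.lean` (its body VERBATIM, so that the
lead can close `stub_tamagawaParityR0` by name): for `Wd, A / ℚ` globally minimal, `p ≥ 5` on the cell
(G-ord, `e = 2`) of `Wd` (so `Wd` is additive at `p`), `K''` a `p`-ramified Kolyvagin field of the pair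
(`ThreeFieldRoadSupply.RamifiedKolyvaginField`), `A ≅ Wd ⊗ χ_{d_{K''}}` good ordinary at `p`:
`ord_p ∏_ℓ c_ℓ(A) = ord_p ∏_ℓ c_ℓ(Wd)`. No definition, no named fact.

PROOF (prime by prime, as in `X11b/TwistTransportTam`): both Tamagawa products are finite products of
the `p`-adic local Tamagawa numbers over the union of the bad places (`tamagawaProduct_eq_prod`), and
`ord_p c_ℓ(A) = ord_p c_ℓ(Wd)` for every prime `ℓ`
(`padicValNat_localTamagawaNumber_twist_eq_of_ramifiedKolyvaginField`):
* `ℓ = p`: `A` is good at `p` (`c_p(A) = 1`) and `Wd` is additive at `p` (`c_p(Wd) ≤ 4 < p`,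
  Kodaira–Néron, `localTamagawaNumber_padic_le_four`);
* `ℓ ∤ N_{Wd}`: `c_ℓ(Wd) = 1`, and `A` is not multiplicative at `ℓ` (`j(A) = j(Wd)` is `ℓ`-integral,
  `not_hasMultiplicativeReductionAtPrime_of_j_eq`), so `c_ℓ(A) ≤ 4 < p`;
* `ℓ ∣ N_{Wd}`, `ℓ ∤ d_{K''}`: `ℓ` splits in `K''` (field 3 of `RamifiedKolyvaginField`), so `d_{K''}` is a
  square in `ℚ_ℓ` (`isSquare_discr_padic_of_heegner`), `A ⊗ ℚ_ℓ ≅ Wd ⊗ ℚ_ℓ` and `c_ℓ(A) = c_ℓ(Wd)`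
  (`localTamagawaNumber_variableChange_holds`);
* `ℓ ∣ N_{Wd}`, `ℓ ∣ d_{K''}`, `ℓ ≠ p`: `A` is multiplicative NON-SPLIT at `ℓ` (field 4), `c_ℓ(A) ≤ 4`,
  and `Wd` is NOT multiplicative at `ℓ` by the elementary twist lemma
  `not_hasMultiplicativeReductionAtPrime_of_smul_quadraticTwist_discr` of the companion file
  `…TamagawaParityR0Twist` (valid also at `ℓ = 2`), so `c_ℓ(Wd) ≤ 4 < p` as well.

References: [cite: SilvermanAEC2009, VII.5 Prop. 5.1, VII.6 (Ex. 7.6), X.5 Cor. 5.4]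
[cite: SilvermanATAEC1994, Cor. IV.9.2(d) (PDF p. 340)] [cite: JetchevSkinnerWan2017, §7.4.1 (eq:tamK)].
Axioms: `propext`, `Classical.choice`, `Quot.sound`.
-/

set_option autoImplicit false
-- D-0017: single-problem summit, so `Summit.BirchSwinnertonDyer.BirchSwinnertonDyer.…` repeats a namespace BY DESIGN.
set_option linter.dupNamespace false

noncomputable section

open scoped Classical

namespace Summit.BirchSwinnertonDyer.BirchSwinnertonDyer.Theorems.GenusStringentRoadK

open WeierstrassCurve NumberField IsDedekindDomain Rat.HeightOneSpectrum
open Literature.NumberTheory.EllipticCurves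
  Literature.NumberTheory.EllipticCurves.Rank1Residual
  Summit.BirchSwinnertonDyer.Rank1Residual.Additive
  Summit.BirchSwinnertonDyer.Rank1Residual.X11b
open ThreeFieldRoadSupply (RamifiedKolyvaginField)

/-! ### §3 The local Tamagawa numbers, prime by prime -/

/-- **Kodaira–Néron bound in valuation form**: if `X / ℚ` is not split multiplicative at `ℓ` then
`0 < c_ℓ(X) ≤ 4 < 5 ≤ p`, so `ord_p c_ℓ(X) = 0` (Silverman *ATAEC* Cor. IV.9.2(d); tree
`localTamagawaNumber_padic_le_four`, `localTamagawaNumber_padic_ne_zero_holds`).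
[cite: SilvermanATAEC1994, Cor. IV.9.2(d) (PDF p. 340)] -/
theorem padicValNat_localTamagawaNumber_eq_zero_of_not_split (p : ℕ) [Fact p.Prime] (hp5 : 5 ≤ p)
    (X : WeierstrassCurve ℚ) [X.IsElliptic] (ℓ : ℕ) [Fact ℓ.Prime]
    (h : ¬ X.HasSplitMultiplicativeReductionAtPrime ℓ) :
    padicValNat p ((X.baseChange ℚ_[ℓ]).localTamagawaNumber ℤ_[ℓ]) = 0 := by
  haveI : (X.baseChange ℚ_[ℓ]).IsElliptic := inferInstanceAs (X.map (algebraMap ℚ ℚ_[ℓ])).IsElliptic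
  have h4 := localTamagawaNumber_padic_le_four ℓ (X.baseChange ℚ_[ℓ]) h
  have hne := localTamagawaNumber_padic_ne_zero_holds ℓ (X.baseChange ℚ_[ℓ])
  refine padicValNat.eq_zero_of_not_dvd fun hdvd ↦ ?_
  have := Nat.le_of_dvd (Nat.pos_of_ne_zero hne) hdvd
  omega

/-- Equal Weierstrass equations have equal `j` (whatever the `IsElliptic` witnesses). [folklore] -/
private theorem j_eq_of_eq' {R : Type*} [CommRing R] {X Y : WeierstrassCurve R} [X.IsElliptic]
    [Y.IsElliptic] (h : X = Y) : X.j = Y.j := by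
  subst h
  rfl

/-- **`ord_p c_ℓ(A) = ord_p c_ℓ(Wd)` at every prime `ℓ`** for the pair `(Wd, A ≅ Wd ⊗ χ_{d_{K''}})`
of the `p`-ramified Kolyvagin field `K''` (`RamifiedKolyvaginField Wd A p K''`), `p ≥ 5`, `Wd`
additive at `p` (`Addv Wd p`), `A` good at `p`, both globally minimal. Cases: `ℓ = p` (`c_p(A) = 1`,
`c_p(Wd) ≤ 4`); `ℓ ∤ N_{Wd}` (`c_ℓ(Wd) = 1`, `A` not multiplicative by the `j`-invariant,
`c_ℓ(A) ≤ 4`); `ℓ ∣ N_{Wd}`, `ℓ ∤ d_{K''}` (`ℓ` split in `K''`, `d_{K''} ∈ ℚ_ℓ^{×2}`, the curves are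
`ℚ_ℓ`-isomorphic, `c_ℓ` equal); `ℓ ∣ N_{Wd}`, `ℓ ∣ d_{K''}`, `ℓ ≠ p` (`A` non-split multiplicative,
`Wd` not multiplicative by `not_hasMultiplicativeReductionAtPrime_of_smul_quadraticTwist_discr`,
both `c_ℓ ≤ 4 < p`). [cite: SilvermanATAEC1994, Cor. IV.9.2(d) (PDF p. 340)]
[cite: SilvermanAEC2009, VII.5 Prop. 5.1, VII.6 Ex. 7.6 and X.5 Cor. 5.4]
[cite: JetchevSkinnerWan2017, §7.4.1 (eq:tamK)] -/
theorem padicValNat_localTamagawaNumber_twist_eq_of_ramifiedKolyvaginField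
    (Wd : WeierstrassCurve ℚ) [Wd.IsElliptic] [Wd.IsGloballyMinimal] (A : WeierstrassCurve ℚ)
    [A.IsElliptic] [A.IsGloballyMinimal] (p : ℕ) [Fact p.Prime] (K'' : Type) [Field K'']
    [NumberField K''] (hp5 : 5 ≤ p) (hAddv : Addv Wd p) (hK : RamifiedKolyvaginField Wd A p K'')
    (C : VariableChange ℚ) (hA : C • Wd.quadraticTwist (NumberField.discr K'' : ℚ) = A)
    (hgoodA : A.HasGoodReductionAtPrime p) (ℓ : ℕ) [Fact ℓ.Prime] :
    padicValNat p ((A.baseChange ℚ_[ℓ]).localTamagawaNumber ℤ_[ℓ]) =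
      padicValNat p ((Wd.baseChange ℚ_[ℓ]).localTamagawaNumber ℤ_[ℓ]) := by
  have hℓ : ℓ.Prime := Fact.out
  obtain ⟨hIQ, -, hsplit, hram⟩ := hK
  set d : ℚ := (NumberField.discr K'' : ℚ) with hd_def
  have hD0 : d ≠ 0 := by rw [hd_def]; exact_mod_cast NumberField.discr_ne_zero K''
  haveI : (Wd.baseChange ℚ_[ℓ]).IsElliptic :=
    inferInstanceAs (Wd.map (algebraMap ℚ ℚ_[ℓ])).IsElliptic
  haveI : (A.baseChange ℚ_[ℓ]).IsElliptic :=
    inferInstanceAs (A.map (algebraMap ℚ ℚ_[ℓ])).IsElliptic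
  haveI : (Wd.quadraticTwist d).IsElliptic := Wd.isElliptic_quadraticTwist hD0
  by_cases hℓp : ℓ = p
  · -- `ℓ = p`: `A` good, `Wd` additive
    have hgoodℓ : A.HasGoodReductionAtPrime ℓ := by subst hℓp; exact hgoodA
    have hWdnm : ¬ Wd.HasMultiplicativeReductionAtPrime ℓ := by subst hℓp; exact hAddv.2
    have hcA : (A.baseChange ℚ_[ℓ]).localTamagawaNumber ℤ_[ℓ] = 1 := by
      haveI : ((A.baseChange ℚ_[ℓ]).minimal ℤ_[ℓ]).HasGoodReduction ℤ_[ℓ] := hgoodℓ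
      exact localTamagawaNumber_eq_one_of_hasGoodReduction_holds ℤ_[ℓ] _
    rw [hcA, padicValNat_one_right]
    exact (padicValNat_localTamagawaNumber_eq_zero_of_not_split p hp5 Wd ℓ
      fun hs ↦ hWdnm hs.hasMultiplicativeReductionAtPrime).symm
  by_cases hℓN : ℓ ∣ Wd.conductorNorm ℤ
  · by_cases hℓD : (ℓ : ℤ) ∣ NumberField.discr K''
    · -- `ℓ ∣ N`, `ℓ ∣ d_K''`, `ℓ ≠ p`: `A` non-split multiplicative, `Wd` not multiplicative
      obtain ⟨hAm, hAns⟩ := hram ℓ hℓ hℓN hℓD hℓp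
      have hWdm : ¬ Wd.HasMultiplicativeReductionAtPrime ℓ :=
        not_hasMultiplicativeReductionAtPrime_of_smul_quadraticTwist_discr Wd A K'' hIQ.1 C hA ℓ
          hℓD hAm
      rw [padicValNat_localTamagawaNumber_eq_zero_of_not_split p hp5 A ℓ hAns,
        padicValNat_localTamagawaNumber_eq_zero_of_not_split p hp5 Wd ℓ
          fun hs ↦ hWdm hs.hasMultiplicativeReductionAtPrime]
    · -- `ℓ ∣ N`, `ℓ ∤ d_K''`: `ℓ` splits in `K''`, the two curves are `ℚ_ℓ`-isomorphic
      have hH : SatisfiesHeegnerHypothesis ℓ K'' := hsplit ℓ hℓ hℓN hℓD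
      obtain ⟨θ, hθ⟩ := isSquare_discr_padic_of_heegner K'' hIQ hH ℓ dvd_rfl
      have hθ0 : θ ≠ 0 := by
        rintro rfl
        exact (map_ne_zero (algebraMap ℚ ℚ_[ℓ])).mpr hD0 (hθ.trans (mul_zero 0))
      obtain ⟨C', hC'⟩ :=
        (Wd.baseChange ℚ_[ℓ]).exists_variableChange_smul_eq_quadraticTwist_sq hθ0
      have h1 : (Wd.quadraticTwist d).baseChange ℚ_[ℓ] = C' • Wd.baseChange ℚ_[ℓ] := by
        rw [hC', baseChange, baseChange, map_quadraticTwist, hθ, sq]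
      have hYX : A.baseChange ℚ_[ℓ] =
          (C.map (algebraMap ℚ ℚ_[ℓ]) * C') • Wd.baseChange ℚ_[ℓ] := by
        rw [← hA, WeierstrassCurve.VariableChange.baseChange_smul_eq (Wd.quadraticTwist d) C ℚ_[ℓ],
          h1, mul_smul]
      rw [hYX, localTamagawaNumber_variableChange_holds ℤ_[ℓ] (Wd.baseChange ℚ_[ℓ])
        (C.map (algebraMap ℚ ℚ_[ℓ]) * C')]
  · -- `ℓ ∤ N`: `Wd` is good at `ℓ`, `A` is good or additive at `ℓ`
    have hgood : Wd.HasGoodReductionAtPrime ℓ := by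
      by_contra h
      exact hℓN ((Wd.dvd_conductorNorm_iff_not_hasGoodReductionAtPrime ℓ).mpr h)
    have hcW : (Wd.baseChange ℚ_[ℓ]).localTamagawaNumber ℤ_[ℓ] = 1 := by
      haveI : ((Wd.baseChange ℚ_[ℓ]).minimal ℤ_[ℓ]).HasGoodReduction ℤ_[ℓ] := hgood
      exact localTamagawaNumber_eq_one_of_hasGoodReduction_holds ℤ_[ℓ] _
    have hj : A.j = Wd.j := by
      rw [j_eq_of_eq' hA.symm, variableChange_j]
      exact Wd.j_quadraticTwist hD0
    have hns : ¬ A.HasSplitMultiplicativeReductionAtPrime ℓ := fun hs ↦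
      not_hasMultiplicativeReductionAtPrime_of_j_eq hj ℓ hgood hs.hasMultiplicativeReductionAtPrime
    rw [hcW, padicValNat_one_right]
    exact padicValNat_localTamagawaNumber_eq_zero_of_not_split p hp5 A ℓ hns

/-! ### §4 The Tamagawa products -/

/-- `ord_p` of a finite product of non-zero naturals is the sum of the `ord_p`. [folklore] -/
private theorem padicValNat_prod_eq_sum_aux (p : ℕ) [Fact p.Prime] {ι : Type*} (s : Finset ι)
    (f : ι → ℕ) (hf : ∀ i ∈ s, f i ≠ 0) :
    padicValNat p (∏ i ∈ s, f i) = ∑ i ∈ s, padicValNat p (f i) := by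
  induction s using Finset.induction_on with
  | empty => simp
  | insert a s ha ih =>
    rw [Finset.prod_insert ha, Finset.sum_insert ha,
      padicValNat.mul (hf a (Finset.mem_insert_self a s))
        (Finset.prod_ne_zero_iff.mpr fun i hi => hf i (Finset.mem_insert_of_mem hi)),
      ih fun i hi => hf i (Finset.mem_insert_of_mem hi)]

/-- **`ord_p ∏_ℓ c_ℓ(A) = ord_p ∏_ℓ c_ℓ(Wd)`** for the pair `(Wd, A ≅ Wd ⊗ χ_{d_{K''}})` of a
`p`-ramified Kolyvagin field, `p ≥ 5`, `Wd` additive at `p`, `A` good at `p`, both globally minimal: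
both Tamagawa products are the finite products of the `p`-adic local Tamagawa numbers over the union
of the bad places (`tamagawaProduct_eq_prod`, factors non-zero by
`localTamagawaNumber_padic_ne_zero_holds`), compared prime by prime
(`padicValNat_localTamagawaNumber_twist_eq_of_ramifiedKolyvaginField`).
[cite: JetchevSkinnerWan2017, §7.4.1 (eq:tamK)] [cite: SilvermanATAEC1994, Cor. IV.9.2(d) (PDF p. 340)] -/
theorem padicValNat_tamagawaProduct_twist_eq_of_ramifiedKolyvaginField
    (Wd : WeierstrassCurve ℚ) [Wd.IsElliptic] [Wd.IsGloballyMinimal] (A : WeierstrassCurve ℚ)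
    [A.IsElliptic] [A.IsGloballyMinimal] (p : ℕ) [Fact p.Prime] (K'' : Type) [Field K'']
    [NumberField K''] (hp5 : 5 ≤ p) (hAddv : Addv Wd p) (hK : RamifiedKolyvaginField Wd A p K'')
    (C : VariableChange ℚ) (hA : C • Wd.quadraticTwist (NumberField.discr K'' : ℚ) = A)
    (hgoodA : A.HasGoodReductionAtPrime p) :
    padicValNat p A.tamagawaProduct = padicValNat p Wd.tamagawaProduct := by
  -- the union of the bad places of `Wd` and `A`
  have hfW : (Wd.badPlaces ℤ).Finite := Wd.finite_badPlaces_holds ℤ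
  have hfA : (A.badPlaces ℤ).Finite := A.finite_badPlaces_holds ℤ
  set s : Finset (IsDedekindDomain.HeightOneSpectrum ℤ) := hfW.toFinset ∪ hfA.toFinset with hs
  have hsW : ∀ v, ¬ Wd.HasGoodReductionAt v → v ∈ s := fun v hv ↦
    Finset.mem_union_left _ (by rw [Set.Finite.mem_toFinset, mem_badPlaces_iff]; exact hv)
  have hsA : ∀ v, ¬ A.HasGoodReductionAt v → v ∈ s := fun v hv ↦
    Finset.mem_union_right _ (by rw [Set.Finite.mem_toFinset, mem_badPlaces_iff]; exact hv)
  rw [Literature.NumberTheory.EllipticCurves.tamagawaProduct_eq_prod Wd s hsW,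
    Literature.NumberTheory.EllipticCurves.tamagawaProduct_eq_prod A s hsA,
    padicValNat_prod_eq_sum_aux p s _ fun v _ ↦ ?_, padicValNat_prod_eq_sum_aux p s _ fun v _ ↦ ?_]
  · refine Finset.sum_congr rfl fun v _ ↦ ?_
    haveI := Fact.mk (primesEquiv v).2
    exact padicValNat_localTamagawaNumber_twist_eq_of_ramifiedKolyvaginField Wd A p K'' hp5 hAddv hK
      C hA hgoodA (primesEquiv v)
  · haveI := Fact.mk (primesEquiv v).2
    haveI : (A.baseChange ℚ_[primesEquiv v]).IsElliptic :=
      inferInstanceAs (A.map (algebraMap ℚ ℚ_[primesEquiv v])).IsElliptic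
    exact localTamagawaNumber_padic_ne_zero_holds (primesEquiv v) _
  · haveI := Fact.mk (primesEquiv v).2
    haveI : (Wd.baseChange ℚ_[primesEquiv v]).IsElliptic :=
      inferInstanceAs (Wd.map (algebraMap ℚ ℚ_[primesEquiv v])).IsElliptic
    exact localTamagawaNumber_padic_ne_zero_holds (primesEquiv v) _

/-! ### §5 The stub statement, verbatim -/

/-- **G1, LOCAL PARITY `ord_p ∏c(A) = ord_p ∏c(Wd)`** on the genus joint upper half's binders — the body
of the skeleton's `GenusStringentRoadK.TamagawaParityR0` VERBATIM as a theorem (`A ≅ Wd ⊗ χ_{d_{K″}}`,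
`K″` the `p`-ramified Kolyvagin field, `Wd` on the cell (G-ord, `e = 2`) — only `Addv Wd p` is used —
and `A` good ordinary at `p` — only good reduction is used). Proof:
`padicValNat_tamagawaProduct_twist_eq_of_ramifiedKolyvaginField`.
[cite: SilvermanATAEC1994, Cor. IV.9.2(d) (PDF p. 340)] [cite: SilvermanAEC2009, VII.5 Prop. 5.1 and X.5 Cor. 5.4]
[cite: JetchevSkinnerWan2017, §7.4.1 (eq:tamK)] -/
theorem tamagawaParityR0 :
    ∀ (Wd : WeierstrassCurve ℚ) [Wd.IsElliptic] [Wd.IsGloballyMinimal] (A : WeierstrassCurve ℚ) [A.IsElliptic]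
      [A.IsGloballyMinimal] (p : ℕ) [Fact p.Prime] (K'' : Type) [Field K''] [NumberField K''],
      5 ≤ p → N10.CellGordTwo Wd p → RamifiedKolyvaginField Wd A p K'' →
      (∃ C : VariableChange ℚ, C • Wd.quadraticTwist (NumberField.discr K'' : ℚ) = A) → GoodOrd A p →
      padicValNat p A.tamagawaProduct = padicValNat p Wd.tamagawaProduct := by
  intro Wd _ _ A _ _ p _ K'' _ _ hp5 hcell hK hC hgo
  obtain ⟨C, hA⟩ := hC
  exact padicValNat_tamagawaProduct_twist_eq_of_ramifiedKolyvaginField Wd A p K'' hp5 hcell.2.1 hK C hA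
    hgo.1

end Summit.BirchSwinnertonDyer.BirchSwinnertonDyer.Theorems.GenusStringentRoadK

end
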